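import Mathlib.RingTheory.SimpleModule.Isotypic
import Mathlib.RingTheory.SimpleModule.IsAlgClosed
import Mathlib.FieldTheory.IsAlgClosed.Basic
import Mathlib.LinearAlgebra.FiniteDimensional.Basic
import Mathlib.LinearAlgebra.FiniteDimensional.Lemmas
import Mathlib.LinearAlgebra.Dimension.Free
import Mathlib.Algebra.Algebra.Bilinear
import Mathlib.Algebra.Central.End
import HarnessLib

/-!
# The image of an algebra acting on a multiplicity-free semisimple module (Burnside–Jacobson density form)

F. Lorenz, *Algebra II* (2008), Ch. 28, F20 (Jacobson's density theorem — Mathlib `jacobson_density`) with Schur's lemma over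
an algebraically closed field `K`; used by [Liu2021] App. D §D.4 (l. 5626–5627) and Prop. D.4 (1) («multiplicity one») to read
complex multiplication off the Hecke algebra.  If a `K`-algebra `A` acts on a finite-dimensional `K`-space `V` SEMISIMPLY and
MULTIPLICITY-FREELY (every isotypic component is simple), then
* (B-mf-1) `End_A(V) ≅ K^{components}` (Schur: `End_A(c) = K` for a simple `c`, `K` algebraically closed; Mathlib
  `IsSemisimpleModule.endAlgEquiv`) — `nonempty_algEquiv_end_of_isSimpleModule`, `exists_smul_eq_of_mem_isotypicComponents`,
  `nonempty_endAlgEquiv_pi_field`, `finrank_end_eq_card`;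
* (B-mf-2) the IMAGE of `A` in `End_K(V)` is exactly the algebra of `K`-linear maps preserving every isotypic
  component (density `Module.Finite.toModuleEnd_moduleEnd_surjective` applied to the commutant `End_A(V) = K^{components}`)
  — `exists_smul_eq_of_forall_map_mem`, `mem_range_lsmul_iff`;
* (B-mf-3) hence `dim_K (image) = Σ_c (dim_K c)²`, `dim_K V = Σ_c dim_K c`, the centre of the image (taken inside
  `End_K V`) has `dim_K = #components`, and — all components of the same dimension `d` —
  `#components · dim_K (image) = (dim_K V)² = dim_K Z(image) · dim_K (image)` (`finrank_range_lsmul`,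
  `finrank_eq_sum_finrank_isotypicComponents`, `card_mul_finrank_range_lsmul_eq_sq`, `finrank_center_range_lsmul`,
  `finrank_center_mul_finrank_range_lsmul_eq_sq`).

Theorems only; pure Mathlib; no definition, no named fact, no instance, no `sorry`.  DICTIONARY LINE (cell `hodgecm-mathlib`,
crux `HLiu418` = stmt-HodgeConjecture-24832, d6 S2′ road (6-i), input of ★ `EndomorphismAlgebraFullOverCentralField`): `K := ℚ̄_ℓ`,
`V := ℚ̄_ℓ ⊗ H¹_ét(Im u₀)`, `A :=` the Hecke algebra, components `π_σ^K ⊗ (line)` all of dimension `d_K`: `#σ · dim H_ℚ̄ℓ = (#σ·d_K)²`,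
descending to `[Z:ℚ] · dim_ℚ H = (2g)²`.  Moves no book (HC_CM is proved only modulo the 7 printed citations until rung 0 closes).

## References
* [Lorenz2008] F. Lorenz, *Algebra II: Fields with Structure, Algebras and Advanced Topics*, Springer (2008), Ch. 28,
  F20 (Jacobson density; as cited by Mathlib `RingTheory/SimpleModule/Basic`).
* [Liu2021] Y. Liu, *Fourier–Jacobi cycles and arithmetic relative trace formula*, Camb. J. Math. 9 (2021), App. D
  Prop. D.4 (1) (p. 130) and §D.4 (FJcycle.tex l. 5626–5627).
-/

namespace Literature.RingTheory.SimpleModule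

open Module IsSemisimpleModule

universe u v w

section Main

variable {K : Type u} [Field K] {A : Type v} [Ring A] [Algebra K A]
  {V : Type w} [AddCommGroup V] [Module K V] [Module A V] [IsScalarTower K A V] [SMulCommClass A K V]
  [FiniteDimensional K V] [IsSemisimpleModule A V]

omit [SMulCommClass A K V] [IsSemisimpleModule A V] in
/-- An isotypic component, regarded as a `K`-subspace, is finite-dimensional. [folklore] -/
private theorem finite_component (c : Submodule A V) : Module.Finite K c :=
  Module.Finite.of_injective (c.subtype.restrictScalars K) Subtype.val_injective

omit [SMulCommClass A K V] [IsSemisimpleModule A V] in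
/-- `End_A(c)` is finite-dimensional over `K` (it embeds into `End_K(c)`). [folklore] -/
private theorem finite_end_component (c : Submodule A V) : Module.Finite K (Module.End A c) := by
  haveI := finite_component (K := K) c
  exact Module.Finite.of_injective (LinearMap.restrictScalarsₗ K A c c K) (LinearMap.restrictScalars_injective K)

omit [SMulCommClass A K V] [IsSemisimpleModule A V] in
/-- **Schur over an algebraically closed field**: for a SIMPLE `A`-submodule `c` (finite-dimensional over `K`),
`K ≃ₐ[K] End_A(c)` via the scalars. [cite: Lorenz2008, Ch. 28 F20 (with Schur's lemma)] -/
theorem nonempty_algEquiv_end_of_isSimpleModule [IsAlgClosed K] (c : Submodule A V) [IsSimpleModule A c] :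
    Nonempty (K ≃ₐ[K] Module.End A c) := by
  classical
  haveI := finite_end_component (K := K) c
  haveI : Algebra.IsIntegral K (Module.End A c) := Algebra.IsIntegral.of_finite K _
  exact ⟨AlgEquiv.ofBijective (Algebra.ofId K (Module.End A c)) IsAlgClosed.algebraMap_bijective_of_isIntegral⟩

omit [SMulCommClass A K V] [IsSemisimpleModule A V] in
/-- On a simple component `c`, every `A`-endomorphism `φ` of `V` acts by a scalar: `φ v = t • v` for all `v ∈ c`
(`φ` preserves `c` — isotypic components are fully invariant — and Schur). [cite: Lorenz2008, Ch. 28 F20 (with Schur's lemma)] -/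
theorem exists_smul_eq_of_mem_isotypicComponents [IsAlgClosed K] {c : Submodule A V}
    (hc : c ∈ isotypicComponents A V) [IsSimpleModule A c] (φ : Module.End A V) :
    ∃ t : K, ∀ v ∈ c, φ v = t • v := by
  classical
  have hinv : ∀ v ∈ c, φ v ∈ c := fun v hv => (Submodule.IsFullyInvariant.of_mem_isotypicComponents hc) φ hv
  obtain ⟨e⟩ := nonempty_algEquiv_end_of_isSimpleModule (K := K) c
  obtain ⟨t, ht⟩ := e.surjective (φ.restrict hinv)
  refine ⟨t, fun v hv => ?_⟩
  have he : e t = algebraMap K (Module.End A c) t := by simpa using e.commutes t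
  have h1 : (φ.restrict hinv) ⟨v, hv⟩ = t • (⟨v, hv⟩ : c) := by
    rw [← ht, he, Algebra.algebraMap_eq_smul_one, LinearMap.smul_apply, Module.End.one_apply]
  exact congrArg Subtype.val h1

/-- **(B-mf-1) `End_A(V) ≅ K^{components}` for a multiplicity-free semisimple `V`** (`K` algebraically closed): Mathlib's
`IsSemisimpleModule.endAlgEquiv` (`End_A(V) ≅ Π_c End_A(c)`) followed by Schur on each simple component.
[cite: Lorenz2008, Ch. 28 F20] [cite: Liu2021, App. D Prop. D.4 (1) (p. 130)] -/
theorem nonempty_endAlgEquiv_pi_field [IsAlgClosed K]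
    (hmf : ∀ c : isotypicComponents A V, IsSimpleModule A (c : Submodule A V)) :
    Nonempty (Module.End A V ≃ₐ[K] (isotypicComponents A V → K)) := by
  classical
  refine ⟨(IsSemisimpleModule.endAlgEquiv K A V).trans (AlgEquiv.piCongrRight fun c => ?_)⟩
  haveI := hmf c
  exact (Classical.choice (nonempty_algEquiv_end_of_isSimpleModule (K := K) (c : Submodule A V))).symm

/-- … hence `dim_K End_A(V) = #components`. [cite: Lorenz2008, Ch. 28 F20] -/
theorem finrank_end_eq_card [IsAlgClosed K] [Fintype (isotypicComponents A V)]
    (hmf : ∀ c : isotypicComponents A V, IsSimpleModule A (c : Submodule A V)) :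
    finrank K (Module.End A V) = Fintype.card (isotypicComponents A V) := by
  obtain ⟨e⟩ := nonempty_endAlgEquiv_pi_field (K := K) hmf
  rw [e.toLinearEquiv.finrank_eq, Module.finrank_fintype_fun_eq_card]

/-- **(B-mf-2) Burnside–Jacobson: the image of `A` is every `K`-linear map preserving the isotypic components.**
For `V` semisimple and multiplicity-free over `A` (`K` algebraically closed) and a `K`-linear `f : V → V` with
`f(c) ⊆ c` for every isotypic component `c`, there is `a ∈ A` acting as `f`.  (`f` commutes with `End_A(V) = K^{components}`,
so it is `End_A(V)`-linear, and `A → End_{End_A V}(V)` is onto by Jacobson density.)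
[cite: Lorenz2008, Ch. 28 F20] [cite: Liu2021, App. D §D.4 (FJcycle.tex l. 5626–5627)] -/
theorem exists_smul_eq_of_forall_map_mem [IsAlgClosed K]
    (hmf : ∀ c : isotypicComponents A V, IsSimpleModule A (c : Submodule A V)) (f : V →ₗ[K] V)
    (hf : ∀ c ∈ isotypicComponents A V, ∀ v ∈ c, f v ∈ c) : ∃ a : A, ∀ v, a • v = f v := by
  classical
  haveI : Module.Finite (Module.End A V) V := Module.Finite.of_restrictScalars_finite K (Module.End A V) V
  have hcomm : ∀ (φ : Module.End A V) (v : V), f (φ v) = φ (f v) := by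
    intro φ v
    have hv : v ∈ ⨆ c : isotypicComponents A V, (c : Submodule A V) := by
      rw [← sSup_eq_iSup', sSup_isotypicComponents A V]; exact Submodule.mem_top
    induction hv using Submodule.iSup_induction' with
    | mem c v hv =>
      haveI := hmf c
      obtain ⟨t, ht⟩ := exists_smul_eq_of_mem_isotypicComponents (K := K) c.2 φ
      rw [ht v hv, ht (f v) (hf c c.2 v hv), map_smul]
    | zero => simp
    | add x y _ _ hx hy => simp [map_add, hx, hy]
  let g : Module.End (Module.End A V) V :=
    { toFun := f
      map_add' := map_add f
      map_smul' := fun φ v => hcomm φ v }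
  obtain ⟨a, ha⟩ := Module.Finite.toModuleEnd_moduleEnd_surjective (R := A) (M := V) g
  exact ⟨a, fun v => LinearMap.congr_fun ha v⟩

/-- The image of `A` in `End_K(V)`, characterised: `f` is of the form `v ↦ a • v` iff `f` preserves every isotypic
component. [cite: Lorenz2008, Ch. 28 F20] -/
theorem mem_range_lsmul_iff [IsAlgClosed K]
    (hmf : ∀ c : isotypicComponents A V, IsSimpleModule A (c : Submodule A V)) (f : Module.End K V) :
    f ∈ (Algebra.lsmul K K V : A →ₐ[K] Module.End K V).range ↔
      ∀ c ∈ isotypicComponents A V, ∀ v ∈ c, f v ∈ c := by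
  constructor
  · rintro ⟨a, rfl⟩ c _ v hv
    change a • v ∈ c
    exact c.smul_mem a hv
  · intro hf
    obtain ⟨a, ha⟩ := exists_smul_eq_of_forall_map_mem (K := K) hmf f hf
    exact ⟨a, LinearMap.ext fun v => by change a • v = f v; exact ha v⟩


/-! ### (B-mf-3) Dimensions: `dim (image) = Σ (dim c)²`, `dim V = Σ dim c` -/

omit [Algebra K A] [Module K V] [IsScalarTower K A V] [SMulCommClass A K V] [FiniteDimensional K V]
  [IsSemisimpleModule A V] in
/-- The isotypic components are independent (Mathlib `sSupIndep_isotypicComponents`). [folklore] -/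
private theorem iSupIndep_components : iSupIndep fun c : isotypicComponents A V => (c : Submodule A V) :=
  (sSupIndep_iff _).1 (sSupIndep_isotypicComponents A V)

omit [Algebra K A] [Module K V] [IsScalarTower K A V] [SMulCommClass A K V] [FiniteDimensional K V] in
/-- The isotypic components span (Mathlib `sSup_isotypicComponents`). [folklore] -/
private theorem iSup_components_eq_top : ⨆ c : isotypicComponents A V, (c : Submodule A V) = ⊤ := by
  rw [← sSup_eq_iSup', sSup_isotypicComponents A V]

omit [SMulCommClass A K V] in
/-- **`dim_K V = Σ_c dim_K c`** over the isotypic components. [cite: Lorenz2008, Ch. 28 F20] -/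
theorem finrank_eq_sum_finrank_isotypicComponents [Fintype (isotypicComponents A V)] :
    finrank K V = ∑ c : isotypicComponents A V, finrank K (c : Submodule A V) := by
  classical
  let e : (Π₀ c : isotypicComponents A V, ((c : Submodule A V) : Type w)) ≃ₗ[K] V :=
    ((iSupIndep_components (A := A) (V := V)).linearEquiv iSup_components_eq_top).restrictScalars K
  haveI : ∀ c : isotypicComponents A V, Module.Finite K ((c : Submodule A V) : Type w) :=
    fun c => finite_component (K := K) _
  rw [← e.finrank_eq, (DFinsupp.linearEquivFunOnFintype (R := K)
      (M := fun c : isotypicComponents A V => ((c : Submodule A V) : Type w))).finrank_eq,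
    Module.finrank_pi_fintype K]

/-- **Block maps**: a family `g_c ∈ End_K(c)` assembles to a `K`-linear endomorphism of `V` acting as `g_c` on each
component; the assembly is `K`-linear and injective in `g`, and (multiplicity-free case) lands in the image of `A`.
[cite: Lorenz2008, Ch. 28 F20] -/
private theorem exists_blockMap [IsAlgClosed K]
    (hmf : ∀ c : isotypicComponents A V, IsSimpleModule A (c : Submodule A V)) :
    ∃ Ψ : (∀ c : isotypicComponents A V, Module.End K ((c : Submodule A V) : Type w)) →ₗ[K] Module.End K V,
      Function.Injective Ψ ∧
      (∀ g (c : isotypicComponents A V) (v : V) (hv : v ∈ (c : Submodule A V)),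
        Ψ g v = ((g c ⟨v, hv⟩ : (c : Submodule A V)) : V)) ∧
      ∀ g, Ψ g ∈ (Algebra.lsmul K K V : A →ₐ[K] Module.End K V).range := by
  classical
  have hmem : ∀ f : Module.End K V, f ∈ (Algebra.lsmul K K V : A →ₐ[K] Module.End K V).range ↔
      ∀ c ∈ isotypicComponents A V, ∀ v ∈ c, f v ∈ c := fun f => mem_range_lsmul_iff (K := K) hmf f
  have ind := iSupIndep_components (A := A) (V := V)
  have htop := iSup_components_eq_top (A := A) (V := V)
  let e : (Π₀ c : isotypicComponents A V, ((c : Submodule A V) : Type w)) ≃ₗ[K] V :=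
    (ind.linearEquiv htop).restrictScalars K
  have he_symm : ∀ (c : isotypicComponents A V) (x : V) (hx : x ∈ (c : Submodule A V)),
      e.symm x = DFinsupp.single c ⟨x, hx⟩ := fun c x hx => ind.linearEquiv_symm_apply htop hx
  have he_single : ∀ (c : isotypicComponents A V) (y : (c : Submodule A V)),
      e (DFinsupp.single c y) = (y : V) := fun c y => by
    have := he_symm c y y.2
    rw [← this, LinearEquiv.apply_symm_apply]
  let Ψ : (∀ c : isotypicComponents A V, Module.End K ((c : Submodule A V) : Type w)) →ₗ[K] Module.End K V :=
    { toFun := fun g => e.toLinearMap ∘ₗ DFinsupp.mapRange.linearMap g ∘ₗ e.symm.toLinearMap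
      map_add' := fun g g' => by
        ext v
        simp only [LinearMap.coe_comp, Function.comp_apply, LinearEquiv.coe_coe, LinearMap.add_apply]
        rw [← map_add]
        congr 1
        ext c
        simp [DFinsupp.mapRange.linearMap_apply]
      map_smul' := fun t g => by
        ext v
        simp only [LinearMap.coe_comp, Function.comp_apply, LinearEquiv.coe_coe, LinearMap.smul_apply,
          RingHom.id_apply]
        rw [← map_smul]
        congr 1
        ext c
        simp [DFinsupp.mapRange.linearMap_apply] }
  have hΨ_apply : ∀ g (c : isotypicComponents A V) (v : V) (hv : v ∈ (c : Submodule A V)),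
      Ψ g v = ((g c ⟨v, hv⟩ : (c : Submodule A V)) : V) := fun g c v hv => by
    change e (DFinsupp.mapRange.linearMap g (e.symm v)) = _
    rw [he_symm c v hv, DFinsupp.mapRange.linearMap_apply, DFinsupp.mapRange_single, he_single]
  refine ⟨Ψ, ?_, hΨ_apply, fun g => (hmem _).2 fun c hc v hv => by
    rw [hΨ_apply g ⟨c, hc⟩ v hv]; exact Subtype.mem _⟩
  intro g g' hgg'
  funext c
  refine LinearMap.ext fun y => Subtype.ext ?_
  have := LinearMap.congr_fun hgg' (y : V)
  rwa [hΨ_apply g c y y.2, hΨ_apply g' c y y.2] at this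

/-- **`dim_K (image of A) = Σ_c (dim_K c)²`** for a multiplicity-free semisimple `V` over an algebraically closed `K`:
the image is the algebra of component-preserving maps (B-mf-2), isomorphic to `Π_c End_K(c)` by restriction.
[cite: Lorenz2008, Ch. 28 F20] [cite: Liu2021, App. D §D.4 (FJcycle.tex l. 5626–5627)] -/
theorem finrank_range_lsmul [IsAlgClosed K] [Fintype (isotypicComponents A V)]
    (hmf : ∀ c : isotypicComponents A V, IsSimpleModule A (c : Submodule A V)) :
    finrank K (Algebra.lsmul K K V : A →ₐ[K] Module.End K V).range =
      ∑ c : isotypicComponents A V, finrank K (c : Submodule A V) ^ 2 := by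
  classical
  set H : Subalgebra K (Module.End K V) := (Algebra.lsmul K K V : A →ₐ[K] Module.End K V).range with hH
  haveI : ∀ c : isotypicComponents A V, Module.Finite K ((c : Submodule A V) : Type w) :=
    fun c => finite_component (K := K) _
  have hmem : ∀ f : Module.End K V, f ∈ H ↔ ∀ c ∈ isotypicComponents A V, ∀ v ∈ c, f v ∈ c :=
    fun f => mem_range_lsmul_iff (K := K) hmf f
  -- the internal direct sum `(Π₀_c c) ≃ V`
  have ind := iSupIndep_components (A := A) (V := V)
  have htop := iSup_components_eq_top (A := A) (V := V)
  have hPi : finrank K (∀ c : isotypicComponents A V, Module.End K ((c : Submodule A V) : Type w)) =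
      ∑ c : isotypicComponents A V, finrank K (c : Submodule A V) ^ 2 := by
    rw [Module.finrank_pi_fintype K]
    exact Finset.sum_congr rfl fun c _ => by rw [Module.finrank_linearMap, sq]
  let Φ : H →ₗ[K] (∀ c : isotypicComponents A V, Module.End K ((c : Submodule A V) : Type w)) :=
    { toFun := fun f => fun c => (f : Module.End K V).restrict
        (p := (c : Submodule A V).restrictScalars K) (q := (c : Submodule A V).restrictScalars K)
        (fun v hv => (hmem f).1 f.2 c c.2 v hv)
      map_add' := fun f g => by ext c v; rfl
      map_smul' := fun t f => by ext c v; rfl }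
  have hΦ : Function.Injective Φ := by
    intro f g hfg
    apply Subtype.ext
    refine LinearMap.ext fun v => ?_
    have hv : v ∈ ⨆ c : isotypicComponents A V, (c : Submodule A V) := by rw [htop]; exact Submodule.mem_top
    induction hv using Submodule.iSup_induction' with
    | mem c v hv =>
      have := congrArg (fun F => ((F c) ⟨v, hv⟩ : V)) hfg
      exact this
    | zero => simp
    | add x y _ _ hx hy => rw [map_add, map_add, hx, hy]
  have hle : finrank K H ≤ ∑ c : isotypicComponents A V, finrank K (c : Submodule A V) ^ 2 := by
    rw [← hPi]; exact LinearMap.finrank_le_finrank_of_injective hΦ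
  -- (≥): the block maps `Π_c End_K(c) → H` are injective
  obtain ⟨Ψ, hΨ, -, hΨH⟩ := exists_blockMap (K := K) hmf
  have hge : ∑ c : isotypicComponents A V, finrank K (c : Submodule A V) ^ 2 ≤ finrank K H := by
    rw [← hPi, ← Subalgebra.finrank_toSubmodule]
    exact LinearMap.finrank_le_finrank_of_injective (f := Ψ.codRestrict (Subalgebra.toSubmodule H) hΨH)
      (fun g g' h => hΨ (by simpa using congrArg Subtype.val h))
  exact le_antisymm hle hge

/-- **Equal component dimension `d`: `#components · dim_K (image of A) = (dim_K V)²`** — the identity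
`[Z : K] · dim H = (dim V)²` behind «multiplicity one ⇒ complex multiplication» (every `π_σ^K` of the same dimension
`d_K`). [cite: Liu2021, App. D Prop. D.4 (1) (p. 130) and §D.4 (FJcycle.tex l. 5626–5627)] -/
theorem card_mul_finrank_range_lsmul_eq_sq [IsAlgClosed K] [Fintype (isotypicComponents A V)]
    (hmf : ∀ c : isotypicComponents A V, IsSimpleModule A (c : Submodule A V)) {d : ℕ}
    (hd : ∀ c : isotypicComponents A V, finrank K (c : Submodule A V) = d) :
    Fintype.card (isotypicComponents A V) * finrank K (Algebra.lsmul K K V : A →ₐ[K] Module.End K V).range =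
      finrank K V ^ 2 := by
  rw [finrank_range_lsmul (K := K) hmf, finrank_eq_sum_finrank_isotypicComponents (K := K) (A := A) (V := V)]
  simp only [hd, Finset.sum_const, Finset.card_univ, smul_eq_mul]
  ring


/-! ### (B-mf-3, centre) `dim_K Z(image) = #components` -/

/-- **The centre of the image of `A` has dimension `#components`** (one scalar per isotypic component): for
`H := image of A ⊆ End_K(V)`, the subalgebra `H ⊓ Z_{End_K V}(H)` (the centre of `H`, taken inside `End_K V`) has
`dim_K = #components` — so that, at equal component dimension, `dim Z(H) · dim H = (dim V)²`
(`card_mul_finrank_range_lsmul_eq_sq`). [cite: Lorenz2008, Ch. 28 F20] [cite: Liu2021, App. D Prop. D.4 (1) (p. 130)] -/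
theorem finrank_center_range_lsmul [IsAlgClosed K] [Fintype (isotypicComponents A V)]
    (hmf : ∀ c : isotypicComponents A V, IsSimpleModule A (c : Submodule A V)) :
    finrank K ↥((Algebra.lsmul K K V : A →ₐ[K] Module.End K V).range ⊓
        Subalgebra.centralizer K ((Algebra.lsmul K K V : A →ₐ[K] Module.End K V).range : Set (Module.End K V))) =
      Fintype.card (isotypicComponents A V) := by
  classical
  set H : Subalgebra K (Module.End K V) := (Algebra.lsmul K K V : A →ₐ[K] Module.End K V).range with hH
  set Zc : Subalgebra K (Module.End K V) := H ⊓ Subalgebra.centralizer K (H : Set (Module.End K V)) with hZc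
  have hmem : ∀ f : Module.End K V, f ∈ H ↔ ∀ c ∈ isotypicComponents A V, ∀ v ∈ c, f v ∈ c :=
    fun f => mem_range_lsmul_iff (K := K) hmf f
  have htop := iSup_components_eq_top (A := A) (V := V)
  have hvtop : ∀ v : V, v ∈ ⨆ c : isotypicComponents A V, (c : Submodule A V) := fun v => by
    rw [htop]; exact Submodule.mem_top
  obtain ⟨Ψ, hΨ, hΨ_apply, hΨH⟩ := exists_blockMap (K := K) hmf
  let sc : (isotypicComponents A V → K) →ₗ[K]
      (∀ c : isotypicComponents A V, Module.End K ((c : Submodule A V) : Type w)) :=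
    { toFun := fun t c => t c • (1 : Module.End K ((c : Submodule A V) : Type w))
      map_add' := fun t t' => by funext c; simp [add_smul]
      map_smul' := fun a t => by funext c; simp [smul_smul] }
  let κ : (isotypicComponents A V → K) →ₗ[K] Module.End K V := Ψ ∘ₗ sc
  have hκ_apply : ∀ t (c : isotypicComponents A V) (v : V), v ∈ (c : Submodule A V) → κ t v = t c • v :=
    fun t c v hv => by
    change Ψ (sc t) v = _
    rw [hΨ_apply (sc t) c v hv]
    rfl
  have hκ_inj : Function.Injective κ := by
    refine hΨ.comp fun t t' htt' => funext fun c => ?_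
    exact smul_left_injective K (one_ne_zero : (1 : Module.End K ((c : Submodule A V) : Type w)) ≠ 0)
      (congrFun htt' c)
  -- `range κ ⊆ Zc`
  have hκZ : ∀ t, κ t ∈ Zc := fun t => by
    refine Algebra.mem_inf.2 ⟨hΨH _, ?_⟩
    rw [Subalgebra.mem_centralizer_iff]
    intro f hf
    refine LinearMap.ext fun v => ?_
    induction hvtop v using Submodule.iSup_induction' with
    | mem c v hv =>
      have hfv : f v ∈ (c : Submodule A V) := (hmem f).1 hf c c.2 v hv
      rw [Module.End.mul_apply, Module.End.mul_apply, hκ_apply t c v hv, hκ_apply t c (f v) hfv, map_smul]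
    | zero => simp
    | add x y _ _ hx hy => rw [map_add, map_add, hx, hy]
  -- `Zc ⊆ range κ`: a central element acts on each component by a scalar (`End_K(c)` is central simple)
  have hZκ : ∀ z ∈ Zc, ∃ t, κ t = z := by
    intro z hz
    obtain ⟨hzH, hzc⟩ := Algebra.mem_inf.1 hz
    rw [Subalgebra.mem_centralizer_iff] at hzc
    have hzinv : ∀ (c : isotypicComponents A V) (v : V), v ∈ (c : Submodule A V) → z v ∈ (c : Submodule A V) :=
      fun c v hv => (hmem z).1 hzH c c.2 v hv
    have key : ∀ c : isotypicComponents A V, ∃ t : K, ∀ v ∈ (c : Submodule A V), z v = t • v := by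
      intro c
      -- the restriction of `z` to `c` commutes with all of `End_K(c)`, hence is a scalar
      let zc : Module.End K ((c : Submodule A V) : Type w) :=
        z.restrict (p := (c : Submodule A V).restrictScalars K) (q := (c : Submodule A V).restrictScalars K)
          (hzinv c)
      have hzc_central : zc ∈ Subalgebra.center K (Module.End K ((c : Submodule A V) : Type w)) := by
        rw [Subalgebra.mem_center_iff]
        intro g
        refine LinearMap.ext fun y => Subtype.ext ?_
        have hG := hzc (Ψ (Pi.single c g)) (hΨH _)
        have := LinearMap.congr_fun hG (y : V)
        rw [Module.End.mul_apply, Module.End.mul_apply, hΨ_apply _ c y y.2,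
          hΨ_apply _ c (z y) (hzinv c y y.2)] at this
        simp only [Pi.single_eq_same] at this
        exact this
      rw [Algebra.IsCentral.center_eq_bot K (Module.End K ((c : Submodule A V) : Type w)), Algebra.mem_bot]
        at hzc_central
      obtain ⟨t, ht⟩ := hzc_central
      refine ⟨t, fun v hv => ?_⟩
      have := LinearMap.congr_fun ht ⟨v, hv⟩
      rw [Algebra.algebraMap_eq_smul_one, LinearMap.smul_apply, Module.End.one_apply] at this
      exact (congrArg Subtype.val this).symm
    choose t ht using key
    refine ⟨t, LinearMap.ext fun v => ?_⟩
    induction hvtop v using Submodule.iSup_induction' with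
    | mem c v hv => rw [hκ_apply t c v hv, ht c v hv]
    | zero => simp
    | add x y _ _ hx hy => rw [map_add, map_add, hx, hy]
  apply le_antisymm
  · -- `Zc ≤ range κ`
    have hle : Subalgebra.toSubmodule Zc ≤ LinearMap.range κ := fun z hz => by
      obtain ⟨t, ht⟩ := hZκ z hz; exact ⟨t, ht⟩
    calc finrank K Zc = finrank K (Subalgebra.toSubmodule Zc) := (Subalgebra.finrank_toSubmodule Zc).symm
      _ ≤ finrank K (LinearMap.range κ) := Submodule.finrank_mono hle
      _ ≤ finrank K (isotypicComponents A V → K) := LinearMap.finrank_range_le κ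
      _ = Fintype.card (isotypicComponents A V) := Module.finrank_fintype_fun_eq_card K
  · rw [← Module.finrank_fintype_fun_eq_card K, ← Subalgebra.finrank_toSubmodule]
    exact LinearMap.finrank_le_finrank_of_injective (f := κ.codRestrict (Subalgebra.toSubmodule Zc) hκZ)
      (fun t t' h => hκ_inj (by simpa using congrArg Subtype.val h))

/-- **`dim_K Z(H) · dim_K H = (dim_K V)²`** for the image `H` of `A` acting semisimply and multiplicity-freely with all
isotypic components of the same dimension — the exact input of ★ `EndomorphismAlgebraFullOverCentralField`
(«(R-split)»). [cite: Liu2021, App. D Prop. D.4 (1) (p. 130) and §D.4 (FJcycle.tex l. 5626–5627)] -/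
theorem finrank_center_mul_finrank_range_lsmul_eq_sq [IsAlgClosed K] [Fintype (isotypicComponents A V)]
    (hmf : ∀ c : isotypicComponents A V, IsSimpleModule A (c : Submodule A V)) {d : ℕ}
    (hd : ∀ c : isotypicComponents A V, finrank K (c : Submodule A V) = d) :
    finrank K ↥((Algebra.lsmul K K V : A →ₐ[K] Module.End K V).range ⊓
        Subalgebra.centralizer K ((Algebra.lsmul K K V : A →ₐ[K] Module.End K V).range : Set (Module.End K V))) *
      finrank K (Algebra.lsmul K K V : A →ₐ[K] Module.End K V).range = finrank K V ^ 2 := by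
  rw [finrank_center_range_lsmul (K := K) hmf, card_mul_finrank_range_lsmul_eq_sq (K := K) hmf hd]

end Main

end Literature.RingTheory.SimpleModule
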